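import Summits.Ventures.QEC.Thresholds.BB144FiniteSizeBounds
import Literature.InformationTheory.QuantumCodes.CSSFiniteSizeBoundsAnisotropic
import HarnessLib

/-!
# `[[72,12,6]]` and `[[144,12,12]]` memory experiments with DIFFERENT data- and measurement-error rates, and under
# qubit-dependent rates: explicit certified failure bounds — UNCONDITIONAL

Venture QEC, `Summits/Ventures/QEC/Thresholds/` (LADDER-QEC Q5 × Q2; qec-type-09 gen 4, item 09.ANISO; continues
`BBFiniteSizeBounds.lean` / `BB144FiniteSizeBounds.lean`, whose phenomenological rows are for `q = p`). In a memory
experiment the measurement-error rate `q` differs from the data-error rate `p`; the Literature file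
`CSSFiniteSizeBoundsAnisotropic.lean` PROVES the DKP15 finite-size bound with `s = √(ρ(1-ρ))` for any `ρ ≥ p, q`
(exponential-Markov half-density bound), and the code-capacity bound for qubit-dependent rates `p_v ≤ ρ`. Instances
(all UNCONDITIONAL, tier CERTIFIED (kernel) via the kernel distances `bb72_d`, `bb144_d`; axioms standard, 0 facts):

| theorem | statement (every minimum-weight (space-time) decoder; `u := 196 ρ(1-ρ)`, `s := √(ρ(1-ρ))`) |
|---|---|
| `bb72_zPhenomFailureProb_le_aniso` / `_x…` | `[[72,12,6]]`, `T` rounds, `0 ≤ p, q ≤ ρ ≤ 1/2`, `14s < 1`: `P_fail(p,q) ≤ 108 T u³/(7(1-14s))` |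
| `bb144_zPhenomFailureProb_le_aniso` / `_x…` | `[[144,12,12]]`: `P_fail(p,q) ≤ 216 T u⁶/(7(1-14s))` |
| `bb72_zFailureProbInhom_le` / `bb144_zFailureProbInhom_le` | code capacity, qubit-dependent rates `p_v ≤ ρ`, `10s < 1`: `≤ 72 (100ρ(1-ρ))³/(5(1-10s))`, `≤ 144 (100ρ(1-ρ))⁶/(5(1-10s))` |
| `bb_zPhenomFailureProb_le_aniso_of_hasParams` | generic census interface: every KERNEL row `HasParams C n k d` ⇒ `P_fail(p,q) ≤ (3n/2)T (14s)^d/(7(1-14s))` |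

## References
* [DumerKovalevPryadko2015] I. Dumer, A. A. Kovalev, L. P. Pryadko, PRL 115 (2015) 050502, Thm 2 (y = 0), Thm 3, p. 5.
* [BravyiEtAl2024] S. Bravyi et al., Nature 627 (2024) 778, Table 1 (the codes) and §4.
-/

noncomputable section

namespace Summit.Ventures.QEC.Thresholds

open Finset Matrix
open Literature.InformationTheory.QuantumCodes
open Summit.Ventures.QEC.BB Summit.Ventures.QEC.Census.BB72 Summit.Ventures.QEC.Census.BB144

/-- `(14 s)^{2j} = (196 ρ(1-ρ))^j`. [folklore] -/
private theorem fourteen_sqrt_pow_two_mul_aniso {ρ : ℝ} (h0 : 0 ≤ ρ) (h1 : ρ ≤ 1) (j : ℕ) :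
    (14 * Real.sqrt (ρ * (1 - ρ))) ^ (2 * j) = (196 * (ρ * (1 - ρ))) ^ j := by
  rw [pow_mul, mul_pow, Real.sq_sqrt (mul_nonneg h0 (by linarith))]
  norm_num

/-- `(10 s)^{2j} = (100 ρ(1-ρ))^j`. [folklore] -/
private theorem ten_sqrt_pow_two_mul_aniso {ρ : ℝ} (h0 : 0 ≤ ρ) (h1 : ρ ≤ 1) (j : ℕ) :
    (10 * Real.sqrt (ρ * (1 - ρ))) ^ (2 * j) = (100 * (ρ * (1 - ρ))) ^ j := by
  rw [pow_mul, mul_pow, Real.sq_sqrt (mul_nonneg h0 (by linarith))]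
  norm_num

/-! ### `[[72, 12, 6]]` -/

/-- **`[[72,12,6]]`, `T` noisy rounds with qubit rate `p` and measurement rate `q`** (`0 ≤ p, q ≤ ρ ≤ 1/2`,
`14√(ρ(1-ρ)) < 1`, EVERY minimum-weight space-time decoder): `P_fail(p,q) ≤ 108 T (196 ρ(1-ρ))³ / (7(1 - 14√(ρ(1-ρ))))`.
UNCONDITIONAL, kernel. [cite: DumerKovalevPryadko2015, Thm 3 with p. 5 (w → w + 2)] -/
theorem bb72_zPhenomFailureProb_le_aniso (T : ℕ)
    {D : CSSPhenom.STDecoder (BB.Mono 6 6) (BB.Mono 6 6 ⊕ BB.Mono 6 6) T}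
    (hD : D.IsMinWeight (CSSPhenom.stSyn BB.bb72.HX T) (CSSPhenom.stCycles BB.bb72.HX T) hammingNorm)
    {p q ρ : ℝ} (hp0 : 0 ≤ p) (hq0 : 0 ≤ q) (hpρ : p ≤ ρ) (hqρ : q ≤ ρ) (hρ : ρ ≤ 1 / 2)
    (hr : 14 * Real.sqrt (ρ * (1 - ρ)) < 1) :
    CSSPhenom.phenomFailureProb BB.bb72.HX T (BB.bb72.css.rowSpZ : Set (BB.Mono 6 6 ⊕ BB.Mono 6 6 → ZMod 2))
        D p q ≤
      108 * T * (196 * (ρ * (1 - ρ))) ^ 3 / (7 * (1 - 14 * Real.sqrt (ρ * (1 - ρ)))) := by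
  have h := BB.zPhenomFailureProb_le_aniso BB.bb72 BB.isBBPoly_bb72.1 BB.isBBPoly_bb72.2 T hD
    (by rw [bb72_d]; norm_num) hp0 hq0 hpρ hqρ hρ hr
  have hpow : (14 * Real.sqrt (ρ * (1 - ρ))) ^ 6 = (196 * (ρ * (1 - ρ))) ^ 3 :=
    fourteen_sqrt_pow_two_mul_aniso (hp0.trans hpρ) (by linarith) 3
  rw [bb72_d, hpow] at h
  convert h using 2
  push_cast
  ring

/-- **`[[72,12,6]]`, `X`-sector twin** (bit flips `p`, measurement errors `q`). UNCONDITIONAL, kernel.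
[cite: DumerKovalevPryadko2015, Thm 3 with p. 5 (w → w + 2)] -/
theorem bb72_xPhenomFailureProb_le_aniso (T : ℕ)
    {D : CSSPhenom.STDecoder (BB.Mono 6 6) (BB.Mono 6 6 ⊕ BB.Mono 6 6) T}
    (hD : D.IsMinWeight (CSSPhenom.stSyn BB.bb72.HZ T) (CSSPhenom.stCycles BB.bb72.HZ T) hammingNorm)
    {p q ρ : ℝ} (hp0 : 0 ≤ p) (hq0 : 0 ≤ q) (hpρ : p ≤ ρ) (hqρ : q ≤ ρ) (hρ : ρ ≤ 1 / 2)
    (hr : 14 * Real.sqrt (ρ * (1 - ρ)) < 1) :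
    CSSPhenom.phenomFailureProb BB.bb72.HZ T (BB.bb72.css.rowSpX : Set (BB.Mono 6 6 ⊕ BB.Mono 6 6 → ZMod 2))
        D p q ≤
      108 * T * (196 * (ρ * (1 - ρ))) ^ 3 / (7 * (1 - 14 * Real.sqrt (ρ * (1 - ρ)))) := by
  have h := BB.xPhenomFailureProb_le_aniso BB.bb72 BB.isBBPoly_bb72.1 BB.isBBPoly_bb72.2 T hD
    (by rw [bb72_d]; norm_num) hp0 hq0 hpρ hqρ hρ hr
  have hpow : (14 * Real.sqrt (ρ * (1 - ρ))) ^ 6 = (196 * (ρ * (1 - ρ))) ^ 3 :=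
    fourteen_sqrt_pow_two_mul_aniso (hp0.trans hpρ) (by linarith) 3
  rw [bb72_d, hpow] at h
  convert h using 2
  push_cast
  ring

open Classical in
/-- **`[[72,12,6]]`, code capacity with qubit-dependent phase-flip rates** `0 ≤ p_v ≤ ρ ≤ 1/2`, `10√(ρ(1-ρ)) < 1`,
EVERY minimum-weight decoder: `P_fail ≤ 72 (100 ρ(1-ρ))³ / (5 (1 - 10√(ρ(1-ρ))))`. UNCONDITIONAL, kernel.
[cite: DumerKovalevPryadko2015, Thm 2 (y = 0, w = 6)] -/
theorem bb72_zFailureProbInhom_le {D : Decoder (BB.Mono 6 6 → ZMod 2) (BB.Mono 6 6 ⊕ BB.Mono 6 6 → ZMod 2)}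
    (hD : D.IsMinWeight BB.bb72.css.zSyndrome (BB.bb72.css.kerX : Set (BB.Mono 6 6 ⊕ BB.Mono 6 6 → ZMod 2))
      hammingNorm)
    {r : BB.Mono 6 6 ⊕ BB.Mono 6 6 → ℝ} {ρ : ℝ} (hr0 : ∀ v, 0 ≤ r v) (hrρ : ∀ v, r v ≤ ρ) (hρ0 : 0 ≤ ρ)
    (hρ : ρ ≤ 1 / 2) (hs : 10 * Real.sqrt (ρ * (1 - ρ)) < 1) :
    ∑ e ∈ univ.filter (fun e : BB.Mono 6 6 ⊕ BB.Mono 6 6 → ZMod 2 =>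
        ¬ D.Corrects BB.bb72.css.zSyndrome (BB.bb72.css.rowSpZ : Set (BB.Mono 6 6 ⊕ BB.Mono 6 6 → ZMod 2)) e),
        indepWeight r (supp e) ≤
      72 * (100 * (ρ * (1 - ρ))) ^ 3 / (5 * (1 - 10 * Real.sqrt (ρ * (1 - ρ)))) := by
  have h := BB.zFailureProbInhom_le BB.bb72 BB.isBBPoly_bb72.1 BB.isBBPoly_bb72.2 hD (by rw [bb72_d]; norm_num)
    hr0 hrρ hρ hs
  have hpow : (10 * Real.sqrt (ρ * (1 - ρ))) ^ 6 = (100 * (ρ * (1 - ρ))) ^ 3 :=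
    ten_sqrt_pow_two_mul_aniso hρ0 (by linarith) 3
  rw [bb72_d, hpow] at h
  convert h using 2
  norm_num

/-! ### `[[144, 12, 12]]` — unconditional (kernel distance certificate `bb144_d`) -/

/-- **`[[144,12,12]]`, `T` noisy rounds with qubit rate `p` and measurement rate `q`** (`0 ≤ p, q ≤ ρ ≤ 1/2`,
`14√(ρ(1-ρ)) < 1`, EVERY minimum-weight space-time decoder): `P_fail(p,q) ≤ 216 T (196 ρ(1-ρ))⁶ / (7(1-14√(ρ(1-ρ))))`.
UNCONDITIONAL, kernel. [cite: DumerKovalevPryadko2015, Thm 3 with p. 5 (w → w + 2)] -/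
theorem bb144_zPhenomFailureProb_le_aniso (T : ℕ)
    {D : CSSPhenom.STDecoder (BB.Mono 12 6) (BB.Mono 12 6 ⊕ BB.Mono 12 6) T}
    (hD : D.IsMinWeight (CSSPhenom.stSyn BB.bb144.HX T) (CSSPhenom.stCycles BB.bb144.HX T) hammingNorm)
    {p q ρ : ℝ} (hp0 : 0 ≤ p) (hq0 : 0 ≤ q) (hpρ : p ≤ ρ) (hqρ : q ≤ ρ) (hρ : ρ ≤ 1 / 2)
    (hr : 14 * Real.sqrt (ρ * (1 - ρ)) < 1) :
    CSSPhenom.phenomFailureProb BB.bb144.HX T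
        (BB.bb144.css.rowSpZ : Set (BB.Mono 12 6 ⊕ BB.Mono 12 6 → ZMod 2)) D p q ≤
      216 * T * (196 * (ρ * (1 - ρ))) ^ 6 / (7 * (1 - 14 * Real.sqrt (ρ * (1 - ρ)))) := by
  have h := BB.zPhenomFailureProb_le_aniso BB.bb144 BB.isBBPoly_bb144.1 BB.isBBPoly_bb144.2 T hD
    (by rw [bb144_d]; norm_num) hp0 hq0 hpρ hqρ hρ hr
  have hpow : (14 * Real.sqrt (ρ * (1 - ρ))) ^ 12 = (196 * (ρ * (1 - ρ))) ^ 6 :=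
    fourteen_sqrt_pow_two_mul_aniso (hp0.trans hpρ) (by linarith) 6
  rw [bb144_d, hpow] at h
  convert h using 2
  push_cast
  ring

/-- **`[[144,12,12]]`, `X`-sector twin** (bit flips `p`, measurement errors `q`). UNCONDITIONAL, kernel.
[cite: DumerKovalevPryadko2015, Thm 3 with p. 5 (w → w + 2)] -/
theorem bb144_xPhenomFailureProb_le_aniso (T : ℕ)
    {D : CSSPhenom.STDecoder (BB.Mono 12 6) (BB.Mono 12 6 ⊕ BB.Mono 12 6) T}
    (hD : D.IsMinWeight (CSSPhenom.stSyn BB.bb144.HZ T) (CSSPhenom.stCycles BB.bb144.HZ T) hammingNorm)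
    {p q ρ : ℝ} (hp0 : 0 ≤ p) (hq0 : 0 ≤ q) (hpρ : p ≤ ρ) (hqρ : q ≤ ρ) (hρ : ρ ≤ 1 / 2)
    (hr : 14 * Real.sqrt (ρ * (1 - ρ)) < 1) :
    CSSPhenom.phenomFailureProb BB.bb144.HZ T
        (BB.bb144.css.rowSpX : Set (BB.Mono 12 6 ⊕ BB.Mono 12 6 → ZMod 2)) D p q ≤
      216 * T * (196 * (ρ * (1 - ρ))) ^ 6 / (7 * (1 - 14 * Real.sqrt (ρ * (1 - ρ)))) := by
  have h := BB.xPhenomFailureProb_le_aniso BB.bb144 BB.isBBPoly_bb144.1 BB.isBBPoly_bb144.2 T hD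
    (by rw [bb144_d]; norm_num) hp0 hq0 hpρ hqρ hρ hr
  have hpow : (14 * Real.sqrt (ρ * (1 - ρ))) ^ 12 = (196 * (ρ * (1 - ρ))) ^ 6 :=
    fourteen_sqrt_pow_two_mul_aniso (hp0.trans hpρ) (by linarith) 6
  rw [bb144_d, hpow] at h
  convert h using 2
  push_cast
  ring

open Classical in
/-- **`[[144,12,12]]`, code capacity with qubit-dependent phase-flip rates** `0 ≤ p_v ≤ ρ ≤ 1/2`,
`10√(ρ(1-ρ)) < 1`, EVERY minimum-weight decoder: `P_fail ≤ 144 (100 ρ(1-ρ))⁶ / (5 (1 - 10√(ρ(1-ρ))))`.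
UNCONDITIONAL, kernel. [cite: DumerKovalevPryadko2015, Thm 2 (y = 0, w = 6)] -/
theorem bb144_zFailureProbInhom_le {D : Decoder (BB.Mono 12 6 → ZMod 2) (BB.Mono 12 6 ⊕ BB.Mono 12 6 → ZMod 2)}
    (hD : D.IsMinWeight BB.bb144.css.zSyndrome
      (BB.bb144.css.kerX : Set (BB.Mono 12 6 ⊕ BB.Mono 12 6 → ZMod 2)) hammingNorm)
    {r : BB.Mono 12 6 ⊕ BB.Mono 12 6 → ℝ} {ρ : ℝ} (hr0 : ∀ v, 0 ≤ r v) (hrρ : ∀ v, r v ≤ ρ) (hρ0 : 0 ≤ ρ)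
    (hρ : ρ ≤ 1 / 2) (hs : 10 * Real.sqrt (ρ * (1 - ρ)) < 1) :
    ∑ e ∈ univ.filter (fun e : BB.Mono 12 6 ⊕ BB.Mono 12 6 → ZMod 2 =>
        ¬ D.Corrects BB.bb144.css.zSyndrome
          (BB.bb144.css.rowSpZ : Set (BB.Mono 12 6 ⊕ BB.Mono 12 6 → ZMod 2)) e),
        indepWeight r (supp e) ≤
      144 * (100 * (ρ * (1 - ρ))) ^ 6 / (5 * (1 - 10 * Real.sqrt (ρ * (1 - ρ)))) := by
  have h := BB.zFailureProbInhom_le BB.bb144 BB.isBBPoly_bb144.1 BB.isBBPoly_bb144.2 hD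
    (by rw [bb144_d]; norm_num) hr0 hrρ hρ hs
  have hpow : (10 * Real.sqrt (ρ * (1 - ρ))) ^ 12 = (100 * (ρ * (1 - ρ))) ^ 6 :=
    ten_sqrt_pow_two_mul_aniso hρ0 (by linarith) 6
  rw [bb144_d, hpow] at h
  convert h using 2
  norm_num

/-! ### Generic census interface -/

/-- **Two-rate phenomenological bound, generic census interface**: every KERNEL row `HasParams C n k d` (`d ≥ 1`)
gives, for `T` rounds with qubit rate `p` and measurement rate `q` (`0 ≤ p, q ≤ ρ ≤ 1/2`, `14 s < 1`) and EVERY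
minimum-weight space-time decoder, `P_fail(p,q) ≤ 3ℓmT · (14 s)^d / (7 (1 - 14 s))`, `s = √(ρ(1-ρ))`. UNCONDITIONAL.
[cite: DumerKovalevPryadko2015, Thm 3 with p. 5 (w → w + 2)] -/
theorem bb_zPhenomFailureProb_le_aniso_of_hasParams {ℓ m : ℕ} [NeZero ℓ] [NeZero m] (C : BB.Code ℓ m)
    (hA : BB.IsBBPoly C.A) (hB : BB.IsBBPoly C.B) {n k d : ℕ} (h : HasParams C n k d) (hd1 : 1 ≤ d) (T : ℕ)
    {D : CSSPhenom.STDecoder (BB.Mono ℓ m) (BB.Mono ℓ m ⊕ BB.Mono ℓ m) T}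
    (hD : D.IsMinWeight (CSSPhenom.stSyn C.HX T) (CSSPhenom.stCycles C.HX T) hammingNorm)
    {p q ρ : ℝ} (hp0 : 0 ≤ p) (hq0 : 0 ≤ q) (hpρ : p ≤ ρ) (hqρ : q ≤ ρ) (hρ : ρ ≤ 1 / 2)
    (hr : 14 * Real.sqrt (ρ * (1 - ρ)) < 1) :
    CSSPhenom.phenomFailureProb C.HX T (C.css.rowSpZ : Set (BB.Mono ℓ m ⊕ BB.Mono ℓ m → ZMod 2)) D p q ≤
      (3 * ℓ * m * T : ℕ) * (14 * Real.sqrt (ρ * (1 - ρ))) ^ d / (7 * (1 - 14 * Real.sqrt (ρ * (1 - ρ)))) := by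
  obtain ⟨-, -, hd⟩ := h
  have h' := BB.zPhenomFailureProb_le_aniso C hA hB T hD (by rw [hd]; exact hd1) hp0 hq0 hpρ hqρ hρ hr
  rw [hd] at h'
  exact h'

end Summit.Ventures.QEC.Thresholds

end
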